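import Literature.AlgebraicTopology.SingularHomology.AttachedCellConcentration
import HarnessLib

/-!
# The relative homology of a closed set with finitely many disjoint closed cells attached
# vanishes off the cell dimensions

Let `Z` be a Hausdorff space, `S₁ ⊆ Z` closed, and `Φᵢ : D^{dᵢ} → Z` (`i` in a finite index type)
continuous injections of closed unit balls with pairwise disjoint images, each meeting `S₁`
exactly along its boundary sphere (`Φᵢ x ∈ S₁ ↔ ‖x‖ = 1`).  Then
**`Hⱼ(S₁ ∪ ⋃ᵢ Φᵢ(D^{dᵢ}), S₁; M) = 0` for every `j` different from all the `dᵢ`.**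

This is the homological companion of the tree's van Kampen statement
`Literature.AlgebraicTopology.FundamentalGroup.isSimplyConnected_union_iUnion_range` (same
hypotheses), i.e. Hatcher's Lemma 2.34 (a) (*Algebraic Topology* (2002), p. 137: *"`Hₖ(Xⁿ, Xⁿ⁻¹)`
is zero for `k ≠ n`"*) for cells attached to an arbitrary closed set rather than to a skeleton,
and the vanishing half of the Remark after Milnor's Thm. 3.14 with Cor. 3.15 (*Lectures on the
h-cobordism theorem* (1965), PDF p. 21: *"`H⁎(W, V)` is isomorphic to `ℤ ⊕ … ⊕ ℤ` in dimension
`λ` and is zero otherwise"*, for `V ∪ D₁ ∪ … ∪ D_k`).  Proof: attach the cells one at a time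
(induction on a finite set of indices); each step is the exact sequence
`Hⱼ(B, S₁) → Hⱼ(B ∪ D', S₁) → Hⱼ(B ∪ D', B)` of the triple together with the one-cell vanishing
`Literature.AlgebraicTopology.SingularHomology.IsAttachedCell.isZero_relativeSingularHomology_union`
(`AttachedCellConcentration.lean`).

## Main result

* `Literature.AlgebraicTopology.SingularHomology.isZero_relativeSingularHomology_union_iUnion_range`.

## References

* A. Hatcher, *Algebraic Topology*, CUP 2002, §2.1, p. 118 (exact sequence of a triple) and
  Lemma 2.34 (a) (p. 137). [HatcherAT2002]
* J. Milnor, *Lectures on the h-cobordism theorem*, Princeton 1965, Remark after Thm. 3.14 and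
  Cor. 3.15 (PDF pp. 19–21). [MilnorHCobordism1965]
-/

noncomputable section

open CategoryTheory Limits Set Metric Function Topology

universe u v

namespace Literature.AlgebraicTopology.SingularHomology

variable (R : Type v) [CommRing R] (M : Type v) [AddCommGroup M] [Module R M]

/-- Local notation: the model space `ℝⁿ`. -/
local notation "𝔼 " n:arg => EuclideanSpace ℝ (Fin n)

/-- Local notation: the closed unit ball `Dⁿ ⊆ ℝⁿ`, as a set. -/
local notation "𝔹 " n:arg => Metric.closedBall (0 : EuclideanSpace ℝ (Fin n)) 1

variable {Z : Type u} [TopologicalSpace Z] [T2Space Z] {ι : Type*} {d : ι → ℕ}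

/-- The image of a continuous injection of a closed ball into a Hausdorff space is closed.
[folklore] -/
theorem isClosed_range_of_injective {k : ℕ} (Φ : C(↥(𝔹 k), Z)) (hinj : Injective Φ) :
    IsClosed (range Φ) :=
  haveI := IsAttachedCell.compactSpace_closedBall k
  (Φ.continuous.isClosedEmbedding hinj).isClosed_range

/-- One step of the induction: attaching one more cell `Φ` to the closed set `B ⊇ S₁` (met by
`Φ` exactly along its boundary sphere, which lies in `S₁`) does not create relative homology off
the cell dimension: if `Hⱼ(B, S₁) = 0` and `j ≠ k` then `Hⱼ(B ∪ D', S₁) = 0` (exact sequence of the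
triple `(B ∪ D', B, S₁)` and the one-cell vanishing `Hⱼ(B ∪ D', B) = 0`).
[cite: HatcherAT2002, §2.1, p. 118 (exact sequence of a triple) and Lemma 2.34 (a)] -/
theorem isZero_relativeSingularHomology_union_range_of_isZero {S₁ B : Set Z} (hSB : S₁ ⊆ B)
    {k : ℕ} {Φ : C(↥(𝔹 k), Z)} (hcell : IsAttachedCell B Φ) {j : ℕ} (hj : j ≠ k)
    (hz : IsZero (relativeSingularHomology R M ↥B (Subtype.val ⁻¹' S₁) j)) :
    IsZero (relativeSingularHomology R M ↥(B ∪ range Φ) (Subtype.val ⁻¹' S₁) j) := by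
  -- the triple `(B ∪ D', B, S₁)` realised on the type `↥(B ∪ D')`
  have hsub : (Subtype.val ⁻¹' S₁ : Set ↥(B ∪ range Φ)) ⊆ Subtype.val ⁻¹' B := fun _ hz => hSB hz
  have hex := relativeSingularHomology.triple_exact₂ R M hsub j
  -- the pair `(B, S₁)` realised on the subtype `↥(B ∪ D') ↓∩ B` is homeomorphic to `(↥B, S₁)`
  have hto : MapsTo (preimageValHomeomorphOfSubset (subset_union_left : B ⊆ B ∪ range Φ))
      (Subtype.val ⁻¹' (Subtype.val ⁻¹' S₁ : Set ↥(B ∪ range Φ)) :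
        Set ↥(Subtype.val ⁻¹' B : Set ↥(B ∪ range Φ)))
      (Subtype.val ⁻¹' S₁ : Set ↥B) := fun _ hz => hz
  have hfrom : MapsTo (preimageValHomeomorphOfSubset (subset_union_left : B ⊆ B ∪ range Φ)).symm
      (Subtype.val ⁻¹' S₁ : Set ↥B)
      (Subtype.val ⁻¹' (Subtype.val ⁻¹' S₁ : Set ↥(B ∪ range Φ)) :
        Set ↥(Subtype.val ⁻¹' B : Set ↥(B ∪ range Φ))) := fun _ hz => hz
  have hX₁ : IsZero (relativeSingularHomology R M
      ↥(Subtype.val ⁻¹' B : Set ↥(B ∪ range Φ))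
      (Subtype.val ⁻¹' (Subtype.val ⁻¹' S₁ : Set ↥(B ∪ range Φ))) j) :=
    hz.of_iso (relativeSingularHomology.mapHomeomorph R M
      (preimageValHomeomorphOfSubset (subset_union_left : B ⊆ B ∪ range Φ)) hto hfrom j)
  have hX₃ := hcell.isZero_relativeSingularHomology_union R M hj
  exact hex.isZero_of_both_zeros (hX₁.eq_of_src _ _) (hX₃.eq_of_tgt _ _)

/-- **`Hⱼ(S₁ ∪ ⋃ᵢ Φᵢ(D^{dᵢ}), S₁; M) = 0` for `j ∉ {dᵢ}`**: finitely many closed cells with pairwise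
disjoint images attached to a closed subset `S₁` of a Hausdorff space along their boundary spheres
(`Φᵢ x ∈ S₁ ↔ ‖x‖ = 1`) carry no relative homology off the cell dimensions (Hatcher 2002,
Lemma 2.34 (a) for cells on a closed set; Milnor 1965, Remark after Thm. 3.14 with Cor. 3.15,
vanishing half).  The homological companion of
`Literature.AlgebraicTopology.FundamentalGroup.isSimplyConnected_union_iUnion_range`.
[cite: HatcherAT2002, Lemma 2.34 (a) (p. 137); MilnorHCobordism1965, Remark after Thm. 3.14 and Cor. 3.15 (PDF pp. 19–21)] -/
theorem isZero_relativeSingularHomology_union_iUnion_range [Finite ι] {S₁ : Set Z}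
    (hS₁ : IsClosed S₁) (Φ : ∀ i, C(↥(𝔹 (d i)), Z))
    (hmem : ∀ i x, Φ i x ∈ S₁ ↔ ‖(x : 𝔼 (d i))‖ = 1) (hinj : ∀ i, Injective (Φ i))
    (hdisj : Pairwise fun i i' => Disjoint (range (Φ i)) (range (Φ i'))) {j : ℕ}
    (hj : ∀ i, j ≠ d i) :
    IsZero (relativeSingularHomology R M ↥(S₁ ∪ ⋃ i, range (Φ i)) (Subtype.val ⁻¹' S₁) j) := by
  classical
  haveI := Fintype.ofFinite ι
  -- the partial unions `B T = S₁ ∪ ⋃ i ∈ T, Φᵢ(D)`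
  let B : Finset ι → Set Z := fun T => S₁ ∪ ⋃ i ∈ T, range (Φ i)
  have hSB : ∀ T, S₁ ⊆ B T := fun T => subset_union_left
  have hBcl : ∀ T, IsClosed (B T) := fun T =>
    hS₁.union (T.finite_toSet.isClosed_biUnion fun i _ => isClosed_range_of_injective (Φ i) (hinj i))
  -- attaching the cell `Φ i`, `i ∉ T`, to `B T`
  have hcell : ∀ (T : Finset ι) (i : ι), i ∉ T → IsAttachedCell (B T) (Φ i) := by
    intro T i hi
    refine ⟨hBcl T, hinj i, fun x => ⟨fun hx => ?_, fun hx => hSB T ((hmem i x).mpr hx)⟩⟩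
    rcases hx with hx | hx
    · exact (hmem i x).mp hx
    · simp only [mem_iUnion, exists_prop] at hx
      obtain ⟨i', hi', hx⟩ := hx
      have hne : i ≠ i' := fun h => hi (h ▸ hi')
      exact absurd (mem_range_self (f := Φ i) x) (disjoint_left.mp (hdisj hne) · hx)
  have hBins : ∀ (T : Finset ι) (i : ι), B (insert i T) = B T ∪ range (Φ i) := by
    intro T i
    change S₁ ∪ ⋃ i' ∈ insert i T, range (Φ i') = (S₁ ∪ ⋃ i' ∈ T, range (Φ i')) ∪ range (Φ i)
    rw [Finset.set_biUnion_insert, union_assoc, union_comm (range (Φ i))]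
  -- induction on `T`
  have hind : ∀ T : Finset ι,
      IsZero (relativeSingularHomology R M ↥(B T) (Subtype.val ⁻¹' S₁) j) := by
    intro T
    induction T using Finset.induction_on with
    | empty =>
      have hB0 : B ∅ = S₁ := by
        change S₁ ∪ ⋃ i ∈ (∅ : Finset ι), range (Φ i) = S₁
        ext z
        simp
      rw [hB0]
      exact relativeSingularHomology.isZero_preimage_self R M S₁ j
    | insert i T hi ih =>
      rw [hBins T i]
      exact isZero_relativeSingularHomology_union_range_of_isZero R M (hSB T) (hcell T i hi)
        (hj i) ih
  have huniv : B Finset.univ = S₁ ∪ ⋃ i, range (Φ i) := by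
    change S₁ ∪ ⋃ i ∈ (Finset.univ : Finset ι), range (Φ i) = S₁ ∪ ⋃ i, range (Φ i)
    congr 1
    ext z
    simp
  rw [← huniv]
  exact hind Finset.univ

end Literature.AlgebraicTopology.SingularHomology
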